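import Summits.Ventures.YMGap.Thresholds.SharpClusteringWilsonWords
import Summits.Ventures.YMGap.Thresholds.SharpClusteringBochner
import HarnessLib

/-!
# Venture YMGap — track (a), R119 brick, part 2/2: the TERMWISE CROSS-LINK HESSIAN BOUND for the
# Wilson potential on `SU(N)^E` (Shen–Zhu–Zhu (4.3)): `|D_{single_e X} D_{single_{e'} Y} S| ≤ h_{ee'} ‖X‖_F ‖Y‖_F`

HONEST FRAMING: venture file (cell `pub-ymgap`, track (a), seat ds-2 for lit-1's R119 line). Pure
finite-dimensional calculus; NO measure, NO threshold, NO clustering statement. Nothing about the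
continuum or the mass gap.

For the Wilson potential `S = wilsonPot d N L β` (`= Nβ Σ_p Re tr(Q_{e₁}Q_{e₂}Q_{e₃}ᴴQ_{e₄}ᴴ)`,
p2's `LatticeBakryEmeryWilson`; `β` is the 't HOOFT coupling, tree coupling `Nβ`, exactly the currency
of p2's `hessBound_wilsonPot : HessBound (wilsonPot β) (N|β|Λ₀)`) on the torus `(ℤ/L)^d`, `L ≥ 2`, and
two DISTINCT positively oriented links `e ≠ e'`, the mixed left-invariant second derivative in the
directions `single_e X`, `single_{e'} Y` (`X, Y ∈ M_N(ℂ)` arbitrary) at a point of `SU(N)^E` obeys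

  `|D_{single_e X} D_{single_{e'} Y} S (Q)| ≤ h(e,e') · ‖X‖_F ‖Y‖_F`,
  `h(e,e') = wilsonH d N L β e e' = N|β| · k(e,e')` for plaquette neighbours `e' ∈ linkNbrT e`, else `0`,

where `k(e,e') = jointPlaq e e'` is the tree's joint-plaquette multiplicity (number of plaquettes
containing both links; `TorusPlaquetteNeighbours.lean`) — Shen–Zhu–Zhu's (4.3) verbatim
(`abs_algD_lk_algD_lk_wilsonPot_le`). The matrix `h` is nonnegative, symmetric, zero on the
diagonal, supported on plaquette neighbours (endpoints within periodic sup-distance `1`,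
`torusNorm_sub_le_one_of_mem_linkNbrT`), with ROW SUMS `Σ_{e'} h(e,e') ≤ 6(d-1)·N|β|`
(`sum_wilsonH_le`, from the tree's double counting `sum_jointPlaq_le`) — i.e. exactly the
hypotheses `hOff / hh0 / hsymm / hrow` (with `H = 6(d-1)N|β|`) of lit-1's weighted Bakry–Émery bound
`SharpClustering.Gam2W_ge` for the Wilson action; the instance
`offDiagHessBound_wilsonPot (hL : 1 < L) (β) : OffDiagHessBound (wilsonPot d N L β) (wilsonH d N L β)`
is the last theorem of this file (`hh0 / hsymm / hrow` are in part 1/2).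
(The side condition `1 < L` only serves to make the four slots of a plaquette distinct links; on the
one-point torus a link occupies two slots of each of its plaquettes and the calculus produces four
words per plaquette pair of slots, not one per plaquette.)

Method: the plaquette word with constant insertions
`W_p(c₁,c₂,c₃)(Q) = Re tr(Q_{s₀} c₁ Q_{s₁} c₂ Q_{s₂}ᴴ c₃ Q_{s₃}ᴴ)` is closed under left-invariant
differentiation (`algD_plaqWordC`: `D_A W_p(c₁,c₂,c₃) = W_p(A_{s₀}c₁,c₂,c₃) + W_p(c₁,A_{s₁}c₂,c₃)
+ W_p(c₁,c₂A_{s₂}ᴴ,c₃) + W_p(c₁,c₂,c₃A_{s₃}ᴴ)`, from p2's `hasDerivAt_reTrWord` along the flow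
`Q e^{tA}`), and at unitary `Q` a word with two non-unitary insertions `a, b` is bounded by
`‖a‖_F ‖b‖_F` (Cauchy–Schwarz for `Re tr`, unitary invariance of `‖·‖_F`).

References: H. Shen, R. Zhu, X. Zhu, CMP 400 (2023) 805–851, Lemma 4.1, (4.3); cell files
`lit/A2-DEBT-MAP.md`, `lit/lean/SharpClusteringBochner.lean` (lit-1, R119). Part 1/2
(`SharpClusteringWilsonWords.lean`) holds the definitions `plaqSlot`, `plaqWordC`, `slotInc`,
`wilsonH` and the row-sum / symmetry facts.
-/

noncomputable section

open scoped Matrix ComplexConjugate BigOperators Matrix.Norms.Frobenius ContDiff Topology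
open Matrix Complex Finset
open Literature.MathematicalPhysics.QuantumFieldTheory
open Summit.Ventures.YMGap.HessianSharp (expWord reTrWord reTrWord_zero hasDerivAt_reTrWord)

namespace Summit.Ventures.YMGap

namespace SharpClustering

open LatticeBakryEmery


section Plaquette

variable {d N : ℕ} {L : ℕ} [NeZero L]

/-! ### Left-invariant derivatives of the plaquette word -/

/-- **The plaquette words are closed under left-invariant differentiation**: for every direction
`A ∈ (E → M_N(ℂ))`,
`D_A W_p(c₁,c₂,c₃) = W_p(A_{s₀}c₁,c₂,c₃) + W_p(c₁,A_{s₁}c₂,c₃) + W_p(c₁,c₂A_{s₂}ᴴ,c₃) + W_p(c₁,c₂,c₃A_{s₃}ᴴ)`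
(product rule along the flow `Q e^{tA}`, p2's `hasDerivAt_reTrWord`). -/
theorem algD_plaqWordC (p : Plaquette d L) (c₁ c₂ c₃ : Matrix (Fin N) (Fin N) ℂ) (A : Cfg (Edge d L) N) :
    algD A (plaqWordC p c₁ c₂ c₃) =
      plaqWordC p (A (plaqSlot p 0) * c₁) c₂ c₃ + plaqWordC p c₁ (A (plaqSlot p 1) * c₂) c₃ +
        plaqWordC p c₁ (c₂ * (A (plaqSlot p 2))ᴴ) c₃ + plaqWordC p c₁ c₂ (c₃ * (A (plaqSlot p 3))ᴴ) := by
  funext Q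
  have h1 := hasDerivAt_comp_mul_exp (contDiff_plaqWordC (N := N) p c₁ c₂ c₃) Q A 0
  rw [zero_smul, NormedSpace.exp_zero, mul_one] at h1
  have h2 : HasDerivAt
      (reTrWord (Q (plaqSlot p 0)) (A (plaqSlot p 0)) (c₁ * Q (plaqSlot p 1)) (A (plaqSlot p 1)) c₂
        (A (plaqSlot p 2))ᴴ ((Q (plaqSlot p 2))ᴴ * c₃) (A (plaqSlot p 3))ᴴ ((Q (plaqSlot p 3))ᴴ))
      (algD A (plaqWordC p c₁ c₂ c₃) Q) 0 :=
    h1.congr_of_eventuallyEq (Filter.Eventually.of_forall fun s => (plaqWordC_mul_exp p c₁ c₂ c₃ Q A s).symm)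
  have h3 := hasDerivAt_reTrWord (Q (plaqSlot p 0)) (A (plaqSlot p 0)) (c₁ * Q (plaqSlot p 1))
    (A (plaqSlot p 1)) c₂ (A (plaqSlot p 2))ᴴ ((Q (plaqSlot p 2))ᴴ * c₃) (A (plaqSlot p 3))ᴴ
    ((Q (plaqSlot p 3))ᴴ) 0
  rw [h2.unique h3]
  simp only [Pi.add_apply, reTrWord_zero, plaqWordC, Matrix.mul_assoc]

/-- **Second left-invariant derivatives of the plaquette term**: sixteen words, one for each ordered
pair of slots receiving the two insertions (grouped by the slot of the inner derivative `A`). -/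
theorem algD_algD_plaqWordC_one (p : Plaquette d L) (A B : Cfg (Edge d L) N) :
    algD B (algD A (plaqWordC (N := N) p 1 1 1)) =
      (plaqWordC p (B (plaqSlot p 0) * A (plaqSlot p 0)) 1 1 +
          plaqWordC p (A (plaqSlot p 0)) (B (plaqSlot p 1)) 1 +
          plaqWordC p (A (plaqSlot p 0)) ((B (plaqSlot p 2))ᴴ) 1 +
          plaqWordC p (A (plaqSlot p 0)) 1 ((B (plaqSlot p 3))ᴴ)) +
      (plaqWordC p (B (plaqSlot p 0)) (A (plaqSlot p 1)) 1 +
          plaqWordC p 1 (B (plaqSlot p 1) * A (plaqSlot p 1)) 1 +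
          plaqWordC p 1 (A (plaqSlot p 1) * (B (plaqSlot p 2))ᴴ) 1 +
          plaqWordC p 1 (A (plaqSlot p 1)) ((B (plaqSlot p 3))ᴴ)) +
      (plaqWordC p (B (plaqSlot p 0)) ((A (plaqSlot p 2))ᴴ) 1 +
          plaqWordC p 1 (B (plaqSlot p 1) * (A (plaqSlot p 2))ᴴ) 1 +
          plaqWordC p 1 ((A (plaqSlot p 2))ᴴ * (B (plaqSlot p 2))ᴴ) 1 +
          plaqWordC p 1 ((A (plaqSlot p 2))ᴴ) ((B (plaqSlot p 3))ᴴ)) +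
      (plaqWordC p (B (plaqSlot p 0)) 1 ((A (plaqSlot p 3))ᴴ) +
          plaqWordC p 1 (B (plaqSlot p 1)) ((A (plaqSlot p 3))ᴴ) +
          plaqWordC p 1 ((B (plaqSlot p 2))ᴴ) ((A (plaqSlot p 3))ᴴ) +
          plaqWordC p 1 1 ((A (plaqSlot p 3))ᴴ * (B (plaqSlot p 3))ᴴ)) := by
  rw [algD_plaqWordC]
  simp only [Matrix.mul_one, Matrix.one_mul]
  have hc := fun c₁ c₂ c₃ => contDiff_plaqWordC (N := N) p c₁ c₂ c₃
  set W₁ := plaqWordC (N := N) p (A (plaqSlot p 0)) 1 1 with hW₁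
  set W₂ := plaqWordC (N := N) p 1 (A (plaqSlot p 1)) 1 with hW₂
  set W₃ := plaqWordC (N := N) p 1 ((A (plaqSlot p 2))ᴴ) 1 with hW₃
  set W₄ := plaqWordC (N := N) p 1 1 ((A (plaqSlot p 3))ᴴ) with hW₄
  have h₁ : ContDiff ℝ ∞ W₁ := hc _ _ _
  have h₂ : ContDiff ℝ ∞ W₂ := hc _ _ _
  have h₃ : ContDiff ℝ ∞ W₃ := hc _ _ _
  have h₄ : ContDiff ℝ ∞ W₄ := hc _ _ _
  have h₁₂ : ContDiff ℝ ∞ (W₁ + W₂) := h₁.add h₂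
  have h₁₂₃ : ContDiff ℝ ∞ (W₁ + W₂ + W₃) := h₁₂.add h₃
  rw [algD_add h₁₂₃ h₄, algD_add h₁₂ h₃, algD_add h₁ h₂, hW₁, hW₂, hW₃, hW₄, algD_plaqWordC,
    algD_plaqWordC, algD_plaqWordC, algD_plaqWordC]
  simp only [Matrix.mul_one, Matrix.one_mul]

/-! ### Bounds for the words at points of `SU(N)^E` -/

section UnitaryPoint

variable (p : Plaquette d L) (g : PSU (Edge d L) N)

omit [NeZero L] in
/-- Links of an `SU(N)^E` configuration are unitary. -/
private theorem memU (e : Edge d L) : (g e : Matrix (Fin N) (Fin N) ℂ) ∈ Matrix.unitaryGroup (Fin N) ℂ :=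
  Matrix.specialUnitaryGroup_le_unitaryGroup (g e).2

omit [NeZero L] in
/-- … and so are their adjoints. -/
private theorem memU_ct (e : Edge d L) : (g e : Matrix (Fin N) (Fin N) ℂ)ᴴ ∈ Matrix.unitaryGroup (Fin N) ℂ := by
  rw [← Matrix.star_eq_conjTranspose]; exact Unitary.star_mem (memU g e)

omit [NeZero L] in
/-- Pattern `(a, b, 1)`. -/
theorem abs_plaqWordC_ab_one_le (a b : Matrix (Fin N) (Fin N) ℂ) :
    |plaqWordC p a b 1 (emb g)| ≤ frobNorm a * frobNorm b := by
  simp only [plaqWordC, emb_apply]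
  set U0 : Matrix (Fin N) (Fin N) ℂ := ↑(g (plaqSlot p 0))
  set U1 : Matrix (Fin N) (Fin N) ℂ := ↑(g (plaqSlot p 1))
  set U2 : Matrix (Fin N) (Fin N) ℂ := ↑(g (plaqSlot p 2))
  set U3 : Matrix (Fin N) (Fin N) ℂ := ↑(g (plaqSlot p 3))
  rw [show U0 * a * U1 * b * U2ᴴ * 1 * U3ᴴ = U0 * (a * U1 * b * (U2ᴴ * U3ᴴ)) by
      simp only [Matrix.mul_one, Matrix.mul_assoc], Matrix.trace_mul_comm,
    show a * U1 * b * (U2ᴴ * U3ᴴ) * U0 = a * U1 * b * (U2ᴴ * U3ᴴ * U0) by simp only [Matrix.mul_assoc]]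
  exact abs_re_trace_word_two_le (memU g _) (mul_mem (mul_mem (memU_ct g _) (memU_ct g _)) (memU g _))

omit [NeZero L] in
/-- Pattern `(a, 1, b)`. -/
theorem abs_plaqWordC_a_one_b_le (a b : Matrix (Fin N) (Fin N) ℂ) :
    |plaqWordC p a 1 b (emb g)| ≤ frobNorm a * frobNorm b := by
  simp only [plaqWordC, emb_apply]
  set U0 : Matrix (Fin N) (Fin N) ℂ := ↑(g (plaqSlot p 0))
  set U1 : Matrix (Fin N) (Fin N) ℂ := ↑(g (plaqSlot p 1))
  set U2 : Matrix (Fin N) (Fin N) ℂ := ↑(g (plaqSlot p 2))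
  set U3 : Matrix (Fin N) (Fin N) ℂ := ↑(g (plaqSlot p 3))
  rw [show U0 * a * U1 * 1 * U2ᴴ * b * U3ᴴ = U0 * (a * (U1 * U2ᴴ) * b * U3ᴴ) by
      simp only [Matrix.mul_one, Matrix.mul_assoc], Matrix.trace_mul_comm,
    show a * (U1 * U2ᴴ) * b * U3ᴴ * U0 = a * (U1 * U2ᴴ) * b * (U3ᴴ * U0) by simp only [Matrix.mul_assoc]]
  exact abs_re_trace_word_two_le (mul_mem (memU g _) (memU_ct g _)) (mul_mem (memU_ct g _) (memU g _))

omit [NeZero L] in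
/-- Pattern `(1, a, b)`. -/
theorem abs_plaqWordC_one_ab_le (a b : Matrix (Fin N) (Fin N) ℂ) :
    |plaqWordC p 1 a b (emb g)| ≤ frobNorm a * frobNorm b := by
  simp only [plaqWordC, emb_apply]
  set U0 : Matrix (Fin N) (Fin N) ℂ := ↑(g (plaqSlot p 0))
  set U1 : Matrix (Fin N) (Fin N) ℂ := ↑(g (plaqSlot p 1))
  set U2 : Matrix (Fin N) (Fin N) ℂ := ↑(g (plaqSlot p 2))
  set U3 : Matrix (Fin N) (Fin N) ℂ := ↑(g (plaqSlot p 3))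
  rw [show U0 * 1 * U1 * a * U2ᴴ * b * U3ᴴ = U0 * U1 * (a * U2ᴴ * b * U3ᴴ) by
      simp only [Matrix.mul_one, Matrix.mul_assoc], Matrix.trace_mul_comm,
    show a * U2ᴴ * b * U3ᴴ * (U0 * U1) = a * U2ᴴ * b * (U3ᴴ * (U0 * U1)) by simp only [Matrix.mul_assoc]]
  exact abs_re_trace_word_two_le (memU_ct g _) (mul_mem (memU_ct g _) (mul_mem (memU g _) (memU g _)))

omit [NeZero L] in
/-- Pattern `(a·b, 1, 1)`. -/
theorem abs_plaqWordC_mul_one_one_le (a b : Matrix (Fin N) (Fin N) ℂ) :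
    |plaqWordC p (a * b) 1 1 (emb g)| ≤ frobNorm a * frobNorm b := by
  simp only [plaqWordC, emb_apply]
  set U0 : Matrix (Fin N) (Fin N) ℂ := ↑(g (plaqSlot p 0))
  set U1 : Matrix (Fin N) (Fin N) ℂ := ↑(g (plaqSlot p 1))
  set U2 : Matrix (Fin N) (Fin N) ℂ := ↑(g (plaqSlot p 2))
  set U3 : Matrix (Fin N) (Fin N) ℂ := ↑(g (plaqSlot p 3))
  rw [show U0 * (a * b) * U1 * 1 * U2ᴴ * 1 * U3ᴴ = U0 * (a * 1 * b * (U1 * U2ᴴ * U3ᴴ)) by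
      simp only [Matrix.mul_one, Matrix.mul_assoc], Matrix.trace_mul_comm,
    show a * 1 * b * (U1 * U2ᴴ * U3ᴴ) * U0 = a * 1 * b * (U1 * U2ᴴ * U3ᴴ * U0) by simp only [Matrix.mul_assoc]]
  exact abs_re_trace_word_two_le (one_mem _)
    (mul_mem (mul_mem (mul_mem (memU g _) (memU_ct g _)) (memU_ct g _)) (memU g _))

omit [NeZero L] in
/-- Pattern `(1, a·b, 1)`. -/
theorem abs_plaqWordC_one_mul_one_le (a b : Matrix (Fin N) (Fin N) ℂ) :
    |plaqWordC p 1 (a * b) 1 (emb g)| ≤ frobNorm a * frobNorm b := by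
  simp only [plaqWordC, emb_apply]
  set U0 : Matrix (Fin N) (Fin N) ℂ := ↑(g (plaqSlot p 0))
  set U1 : Matrix (Fin N) (Fin N) ℂ := ↑(g (plaqSlot p 1))
  set U2 : Matrix (Fin N) (Fin N) ℂ := ↑(g (plaqSlot p 2))
  set U3 : Matrix (Fin N) (Fin N) ℂ := ↑(g (plaqSlot p 3))
  rw [show U0 * 1 * U1 * (a * b) * U2ᴴ * 1 * U3ᴴ = U0 * U1 * (a * 1 * b * (U2ᴴ * U3ᴴ)) by
      simp only [Matrix.mul_one, Matrix.mul_assoc], Matrix.trace_mul_comm,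
    show a * 1 * b * (U2ᴴ * U3ᴴ) * (U0 * U1) = a * 1 * b * (U2ᴴ * U3ᴴ * (U0 * U1)) by
      simp only [Matrix.mul_assoc]]
  exact abs_re_trace_word_two_le (one_mem _)
    (mul_mem (mul_mem (memU_ct g _) (memU_ct g _)) (mul_mem (memU g _) (memU g _)))

omit [NeZero L] in
/-- Pattern `(1, 1, a·b)`. -/
theorem abs_plaqWordC_one_one_mul_le (a b : Matrix (Fin N) (Fin N) ℂ) :
    |plaqWordC p 1 1 (a * b) (emb g)| ≤ frobNorm a * frobNorm b := by
  simp only [plaqWordC, emb_apply]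
  set U0 : Matrix (Fin N) (Fin N) ℂ := ↑(g (plaqSlot p 0))
  set U1 : Matrix (Fin N) (Fin N) ℂ := ↑(g (plaqSlot p 1))
  set U2 : Matrix (Fin N) (Fin N) ℂ := ↑(g (plaqSlot p 2))
  set U3 : Matrix (Fin N) (Fin N) ℂ := ↑(g (plaqSlot p 3))
  rw [show U0 * 1 * U1 * 1 * U2ᴴ * (a * b) * U3ᴴ = U0 * U1 * U2ᴴ * (a * 1 * b * U3ᴴ) by
      simp only [Matrix.mul_one, Matrix.mul_assoc], Matrix.trace_mul_comm,
    show a * 1 * b * U3ᴴ * (U0 * U1 * U2ᴴ) = a * 1 * b * (U3ᴴ * (U0 * U1 * U2ᴴ)) by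
      simp only [Matrix.mul_assoc]]
  exact abs_re_trace_word_two_le (one_mem _)
    (mul_mem (memU_ct g _) (mul_mem (mul_mem (memU g _) (memU g _)) (memU_ct g _)))

/-- Triangle inequality for four terms with given bounds. -/
theorem abs_add_four_le {x₁ x₂ x₃ x₄ c₁ c₂ c₃ c₄ : ℝ} (h₁ : |x₁| ≤ c₁) (h₂ : |x₂| ≤ c₂) (h₃ : |x₃| ≤ c₃)
    (h₄ : |x₄| ≤ c₄) : |x₁ + x₂ + x₃ + x₄| ≤ c₁ + c₂ + c₃ + c₄ :=
  (abs_add_le _ _).trans (add_le_add ((abs_add_le _ _).trans (add_le_add ((abs_add_le _ _).trans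
    (add_le_add h₁ h₂)) h₃)) h₄)

/-- **The mixed second derivative of one plaquette term at a point of `SU(N)^E`**:
`|D_B D_A W_p(1,1,1)(Q)| ≤ (Σ_j ‖B_{s_j}‖_F)(Σ_k ‖A_{s_k}‖_F)`. -/
theorem abs_algD_algD_plaqWordC_le (A B : Cfg (Edge d L) N) :
    |algD B (algD A (plaqWordC (N := N) p 1 1 1)) (emb g)| ≤
      (frobNorm (B (plaqSlot p 0)) + frobNorm (B (plaqSlot p 1)) + frobNorm (B (plaqSlot p 2)) +
          frobNorm (B (plaqSlot p 3))) *
        (frobNorm (A (plaqSlot p 0)) + frobNorm (A (plaqSlot p 1)) + frobNorm (A (plaqSlot p 2)) +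
          frobNorm (A (plaqSlot p 3))) := by
  rw [algD_algD_plaqWordC_one]
  simp only [Pi.add_apply]
  -- group 1 (inner insertion at slot 0)
  have t11 := abs_plaqWordC_mul_one_one_le p g (B (plaqSlot p 0)) (A (plaqSlot p 0))
  have t12 := abs_plaqWordC_ab_one_le p g (A (plaqSlot p 0)) (B (plaqSlot p 1))
  have t13 := abs_plaqWordC_ab_one_le p g (A (plaqSlot p 0)) ((B (plaqSlot p 2))ᴴ)
  have t14 := abs_plaqWordC_a_one_b_le p g (A (plaqSlot p 0)) ((B (plaqSlot p 3))ᴴ)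
  -- group 2 (slot 1)
  have t21 := abs_plaqWordC_ab_one_le p g (B (plaqSlot p 0)) (A (plaqSlot p 1))
  have t22 := abs_plaqWordC_one_mul_one_le p g (B (plaqSlot p 1)) (A (plaqSlot p 1))
  have t23 := abs_plaqWordC_one_mul_one_le p g (A (plaqSlot p 1)) ((B (plaqSlot p 2))ᴴ)
  have t24 := abs_plaqWordC_one_ab_le p g (A (plaqSlot p 1)) ((B (plaqSlot p 3))ᴴ)
  -- group 3 (slot 2)
  have t31 := abs_plaqWordC_ab_one_le p g (B (plaqSlot p 0)) ((A (plaqSlot p 2))ᴴ)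
  have t32 := abs_plaqWordC_one_mul_one_le p g (B (plaqSlot p 1)) ((A (plaqSlot p 2))ᴴ)
  have t33 := abs_plaqWordC_one_mul_one_le p g ((A (plaqSlot p 2))ᴴ) ((B (plaqSlot p 2))ᴴ)
  have t34 := abs_plaqWordC_one_ab_le p g ((A (plaqSlot p 2))ᴴ) ((B (plaqSlot p 3))ᴴ)
  -- group 4 (slot 3)
  have t41 := abs_plaqWordC_a_one_b_le p g (B (plaqSlot p 0)) ((A (plaqSlot p 3))ᴴ)
  have t42 := abs_plaqWordC_one_ab_le p g (B (plaqSlot p 1)) ((A (plaqSlot p 3))ᴴ)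
  have t43 := abs_plaqWordC_one_ab_le p g ((B (plaqSlot p 2))ᴴ) ((A (plaqSlot p 3))ᴴ)
  have t44 := abs_plaqWordC_one_one_mul_le p g ((A (plaqSlot p 3))ᴴ) ((B (plaqSlot p 3))ᴴ)
  refine (abs_add_four_le (abs_add_four_le t11 t12 t13 t14) (abs_add_four_le t21 t22 t23 t24)
    (abs_add_four_le t31 t32 t33 t34) (abs_add_four_le t41 t42 t43 t44)).trans (le_of_eq ?_)
  simp only [frobNorm_conjTranspose]
  ring

end UnitaryPoint

end Plaquette

/-! ### The termwise cross-link Hessian bound for the Wilson potential -/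

section Main

variable {d N : ℕ} {L : ℕ} [NeZero L]

/-- **Slot form, every torus side `L ≥ 1`**: for any two links `e, e'` (distinct or not) and
arbitrary `X, Y ∈ M_N(ℂ)`, at every point of `SU(N)^E`,
`|D_{single_e X} D_{single_{e'} Y} S_W| ≤ N|β| · (Σ_p slotInc p e · slotInc p e') · ‖X‖_F ‖Y‖_F` —
the count is over ordered pairs of plaquette slots (for `L ≥ 2` and `e ≠ e'` it is `jointPlaq e e'`,
`sum_slotInc_mul_eq_jointPlaq`). -/
theorem abs_algD_lk_algD_lk_wilsonPot_le_slots (β : ℝ) (g : PSU (Edge d L) N) (e e' : Edge d L)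
    (X Y : Matrix (Fin N) (Fin N) ℂ) :
    |algD (lk e X) (algD (lk e' Y) (wilsonPot d N L β)) (emb g)| ≤
      (N : ℝ) * |β| * ((∑ p : Plaquette d L, slotInc p e * slotInc p e' : ℕ) : ℝ) *
        frobNorm X * frobNorm Y := by
  classical
  have hc0 : ContDiff ℝ ∞ (wilsonPot₀ d N L) := contDiff_of_mem_polySpace wilsonPot₀_mem_polySpace
  have hW : ∀ p : Plaquette d L, ContDiff ℝ ∞ (plaqWordC (N := N) p 1 1 1) := fun p => contDiff_plaqWordC p 1 1 1
  have key : algD (lk e X) (algD (lk e' Y) (wilsonPot d N L β)) = fun Q =>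
      (N : ℝ) * β * ∑ p : Plaquette d L, algD (lk e X) (algD (lk e' Y) (plaqWordC p 1 1 1)) Q := by
    rw [wilsonPot_eq, algD_const_mul hc0, algD_const_mul (contDiff_algD hc0 _), wilsonPot₀_eq_sum_plaqWordC,
      algD_sum univ (F := fun p => plaqWordC (N := N) p 1 1 1) (fun p _ => hW p),
      algD_sum univ (F := fun p => algD (lk e' Y) (plaqWordC (N := N) p 1 1 1))
        (fun p _ => contDiff_algD (hW p) _)]
  rw [key]
  simp only
  have hX := frobNorm_nonneg X
  have hY := frobNorm_nonneg Y
  have hterm : ∀ p : Plaquette d L,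
      |algD (lk e X) (algD (lk e' Y) (plaqWordC (N := N) p 1 1 1)) (emb g)| ≤
        ((slotInc p e * slotInc p e' : ℕ) : ℝ) * (frobNorm X * frobNorm Y) := fun p => by
    refine (abs_algD_algD_plaqWordC_le p g (lk e' Y) (lk e X)).trans (le_of_eq ?_)
    rw [sum_frobNorm_lk_slots, sum_frobNorm_lk_slots]
    push_cast
    ring
  have hsum : |∑ p : Plaquette d L, algD (lk e X) (algD (lk e' Y) (plaqWordC (N := N) p 1 1 1)) (emb g)| ≤
      ((∑ p : Plaquette d L, slotInc p e * slotInc p e' : ℕ) : ℝ) * (frobNorm X * frobNorm Y) := by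
    refine (Finset.abs_sum_le_sum_abs _ _).trans ((Finset.sum_le_sum fun p _ => hterm p).trans (le_of_eq ?_))
    rw [← Finset.sum_mul]
    push_cast
    rfl
  rw [abs_mul, abs_mul, Nat.abs_cast]
  calc (N : ℝ) * |β| * |∑ p : Plaquette d L, algD (lk e X) (algD (lk e' Y) (plaqWordC (N := N) p 1 1 1)) (emb g)|
      ≤ (N : ℝ) * |β| * (((∑ p : Plaquette d L, slotInc p e * slotInc p e' : ℕ) : ℝ) *
          (frobNorm X * frobNorm Y)) := mul_le_mul_of_nonneg_left hsum (by positivity)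
    _ = _ := by ring

/-- **Termwise cross-link Hessian bound for the Wilson potential (Shen–Zhu–Zhu (4.3)).** On a torus
of side `L ≥ 2`, for distinct links `e ≠ e'`, arbitrary `X, Y ∈ M_N(ℂ)` and every `Q ∈ SU(N)^E`:
`|D_{single_e X} D_{single_{e'} Y} S_W(Q)| ≤ h(e,e') ‖X‖_F ‖Y‖_F` with `h = wilsonH d N L β`
(`= N|β| · #{plaquettes ∋ e, e'}` for plaquette neighbours, `0` otherwise; `β` = 't Hooft coupling,
tree coupling `Nβ`). -/
theorem abs_algD_lk_algD_lk_wilsonPot_le (hL : 1 < L) (β : ℝ) (g : PSU (Edge d L) N) {e e' : Edge d L}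
    (hne : e ≠ e') (X Y : Matrix (Fin N) (Fin N) ℂ) :
    |algD (lk e X) (algD (lk e' Y) (wilsonPot d N L β)) (emb g)| ≤
      wilsonH d N L β e e' * frobNorm X * frobNorm Y := by
  have h := abs_algD_lk_algD_lk_wilsonPot_le_slots β g e e' X Y
  rw [sum_slotInc_mul_eq_jointPlaq hL e e'] at h
  by_cases hn : e' ∈ linkNbrT e
  · rwa [wilsonH, if_pos hn]
  · rw [jointPlaq_eq_zero_of_not_mem hne hn, Nat.cast_zero, mul_zero] at h
    rw [wilsonH, if_neg hn]
    exact h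

/-- **(W2) The Wilson instance of `OffDiagHessBound`** (lit-1's R119 hypothesis `hOff`, Shen–Zhu–Zhu
(4.3)): on every torus of side `L ≥ 2`, at every 't Hooft coupling `β`,
`OffDiagHessBound (wilsonPot d N L β) (wilsonH d N L β)`. Together with `wilsonH_nonneg`,
`wilsonH_symm`, `sum_wilsonH_le` (`H = 6(d-1)N|β|`) and p2's `hessBound_wilsonPot` this feeds
`SharpClustering.Gam2W_ge` for the Wilson action. (`L = 1` is excluded: there a link fills two slots
of each of its plaquettes and the plaquette-count form of (4.3) is not what the calculus gives.) -/
theorem offDiagHessBound_wilsonPot (hL : 1 < L) (β : ℝ) :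
    OffDiagHessBound (wilsonPot d N L β) (wilsonH d N L β) :=
  fun g _ _ hne X Y _ _ _ _ => abs_algD_lk_algD_lk_wilsonPot_le hL β g hne X Y

end Main


end SharpClustering

end Summit.Ventures.YMGap
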